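/-
Copyright (c) 2026. All rights reserved.
Released under Apache 2.0 license as described in the file LICENSE.
Authors: HodgeCM publication cell (pub-hodgecm), model-construction sub-cell, construction prover `mc-weil-2`.
-/
import Literature.NumberTheory.Weil1964.AdelicHeisenbergSchrodinger
import Literature.GroupTheory.InvariantFunctionalSplitting
import Mathlib.LinearAlgebra.GeneralLinearGroup.Basic
import HarnessLib

/-!
# The adelic group `Mp_ψ(W_𝔸)` of the global Schrödinger model, `ω_ψ`, and the `Θ`-forced rational section

Topic `NumberTheory/Weil1964`; namespace `Literature.NumberTheory.Weil1964`.  KERNEL MATHEMATICS ONLY: no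
`def … : Prop` record of a published theorem, no `axiom`, no proof hole; every tag is provenance for a
kernel-checked statement.

SETTING.  [GelbartRogawski1991, §3.1 p. 454]: "let `Mp_𝐀(W)` be the group of pairs `(g, M_g)`, `g ∈ Sp_𝐀(W)`,
`M_g` an operator on the space of `ρ_ψ` with `M_g ρ_ψ(h) M_g⁻¹ = ρ_ψ(g h)` … `ω_ψ(g, M_g) = M_g` … the projection
`π : Mp_𝐀(W) → Sp_𝐀(W)` splits uniquely over `Sp_F(W)` [We]; let `i` denote the splitting".  The tree already has
the GENERIC group of such pairs for ANY model `ρ` of a Heisenberg group `Heisenberg B` with `2` invertible: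
weil-1's `MpPsi ρ ≤ Sp(alt B) × GL(S)` (`LocalWeilProjective.lean`, MVW's `S̃p_ψ(W)`, condition (A)), with
`MpPsi.proj` (`π`) and `MpPsi.toOp`.  This file instantiates it at the CONSTRUCTED global Schrödinger
representation `adelicSchrodinger F ι T` on `𝒮(𝔸_F^ι)` (`AdelicHeisenbergSchrodinger.lean`) — no new group is
minted — and builds `i` choice-free from the theta distribution.

WHAT IS HERE (all proved):
* §1 (generic, any `ρ`) `omegaPsi ρ : Representation k (MpPsi ρ) S`, `(g, M) ↦ M` (GR91's `ω_ψ`); the subgroup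
  `MpPsi.fixing ρ Θ ≤ MpPsi ρ` of pairs whose operator fixes a functional `Θ : S → X` (AX2-b's `fixer Θ`,
  `InvariantFunctionalSplitting.lean`, pulled back along `toOp`); and the RIGIDITY PRINCIPLE: if the only
  `Θ`-fixing automorphism of `S` commuting with `ρ(H)` is `1` (`ThetaRigid ρ Θ`, a hypothesis shape discharged in §3),
  then `π` is INJECTIVE on `MpPsi.fixing ρ Θ` (`fixingProj_injective`), so over the subgroup
  `liftable ρ Θ := π(MpPsi.fixing ρ Θ) ≤ Sp(W)` there is a unique `Θ`-fixing section
  `forcedLift : liftable ρ Θ →* MpPsi ρ` (`proj_forcedLift`, `forcedLift_mem_fixing`, `eq_forcedLift`); two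
  homomorphisms into `MpPsi ρ` over the same map to `Sp(W)` whose values fix `Θ` agree (`eq_of_proj_eq_of_mem_fixing`);
  `liftable` contains the closure of any set of liftable generators (`closure_le_liftable`).
* §2 (generic) restriction of an intertwining pair `(s, M) ∈ mpPairs ρ` to a sub-representation `W ≤ ρ` stable
  under `M^{±1}` (`restrictEquiv`, `restrict_mem_mpPairs`) — the transfer from operators on all functions
  `X_𝔸 → ℂ` (where weil-1's `levi_mem_mpPairs`, `unipotent_mem_mpPairs`, theta-1/F2's twists and second-degree
  characters live) to `𝒮(𝔸_F^ι)`.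
* §3 (the adelic instance) the instance `Invertible (2 : 𝔸_F)`; `adelicMp F ι T := MpPsi (adelicSchrodinger F ι T)`
  (GR91's `Mp_𝐀(W)` on the smooth model); `adelicMpTheta` := the pairs fixing `Θ = thetaDistLM`;
  **`thetaRigid_adelicSchrodinger`**: `ThetaRigid` HOLDS for the global Schrödinger model whenever `y ↦ T y` is
  surjective (from `eq_id_of_commute_of_thetaDist_eq`: theta separation on `𝔸_F^ι / F^ι`); hence
  `adelicThetaLift F ι T hT : liftable … →* adelicMp F ι T` — Weil's `r_F` [Weil1964, Chap. III n° 40 p. 190,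
  Thm 6 n° 41 p. 193] / GR91's `i` on the `Θ`-liftable subgroup of `Sp(W_𝔸)`, with NO choice and no Schur lemma;
  the bridge `toOp p ∈ fixer Θ ↔ ofLinearEquiv (toOp p) ∈ thetaStabilizer F ι` to theta-1's stabiliser.

WHAT IS NOT HERE: that `liftable` contains all of `Sp_F(W)` (it contains the closure of the rational Siegel
parabolic and the Weyl element once their implementers are exhibited: sequel `AdelicMetaplecticGenerators.lean`
+ theta-2's adelic Fourier inversion + the generation theorem `Sp_F(W) = ⟨P(F), w⟩`); continuity / unitarity
statements (GR91 works with the unitary completion; the smooth model suffices for theta series,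
[MoeglinVignerasWaldspurger1987, Chap. 2 II.1] works on `S`).
-/

set_option autoImplicit false

noncomputable section

namespace Literature.NumberTheory.Weil1964

open Literature.RepresentationTheory.HeisenbergGroup
open Literature.GroupTheory.TwistedProduct (fixer mem_fixer_iff)
open Literature.NumberTheory.Automorphic
open NumberField
open scoped Matrix

universe u v u' v'

/-! ## §1 Generic: `ω_ψ`, the `Θ`-fixing subgroup, rigidity ⇒ the forced section -/

section Generic

variable {R : Type u} [CommRing R] [Invertible (2 : R)] {V : Type v} [AddCommGroup V] [Module R V]
  {B : V →ₗ[R] V →ₗ[R] R}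
variable {k : Type u'} [CommRing k] {S : Type v'} [AddCommGroup S] [Module k S]
variable (ρ : Representation k (Heisenberg B) S)

/-- **GR91's `ω_ψ`**: the tautological representation `(g, M_g) ↦ M_g` of `Mp_ψ(W)` on the space of `ρ_ψ`
("Then `ω_ψ(g, M_g) = M_g` defines a representation of `Mp_𝐀(W)` called the oscillator or Weil representation").
[cite: GelbartRogawski1991, §3.1 p. 454] -/
def omegaPsi : Representation k (MpPsi ρ) S :=
  (LinearEquiv.automorphismGroup.toLinearMapMonoidHom (R := k) (M := S)).comp (MpPsi.toOp ρ)

/-- formula `ω_ψ(g, M) f = M f`. [cite: GelbartRogawski1991, §3.1 p. 454] -/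
@[simp] theorem omegaPsi_apply (p : MpPsi ρ) (f : S) :
    omegaPsi ρ p f = (p : symplecticGroup B × (S ≃ₗ[k] S)).2 f := rfl

variable {X : Type*}

/-- **The pairs whose operator fixes a functional `Θ : S → X`** — AX2-b's `fixer Θ ≤ GL(S)` pulled back along
`toOp : Mp_ψ(W) → GL(S)` (for `Θ` the theta distribution: Weil's condition `Θ S = Θ` of [Weil1964, n° 41 Thm 6]).
[folklore] -/
def MpPsi.fixing (Θ : S → X) : Subgroup (MpPsi ρ) := (fixer Θ).comap (MpPsi.toOp ρ)

/-- membership: `(g, M) ∈ fixing Θ ↔ ∀ f, Θ (M f) = Θ f`. [folklore] -/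
theorem MpPsi.mem_fixing_iff (Θ : S → X) (p : MpPsi ρ) :
    p ∈ MpPsi.fixing ρ Θ ↔ ∀ f : S, Θ ((p : symplecticGroup B × (S ≃ₗ[k] S)).2 f) = Θ f := by
  simp only [MpPsi.fixing, Subgroup.mem_comap, mem_fixer_iff, MpPsi.toOp_apply, LinearEquiv.smul_def]

/-- **`Θ`-RIGIDITY of a model** (hypothesis shape, discharged for the global Schrödinger model in §3): the only
linear automorphism of `S` commuting with `ρ(H)` and fixing `Θ` is the identity. [folklore] -/
def ThetaRigid (Θ : S → X) : Prop :=
  ∀ C : S ≃ₗ[k] S, (∀ (h : Heisenberg B) (f : S), C (ρ h f) = ρ h (C f)) → C ∈ fixer Θ → C = 1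

variable {ρ} {Θ : S → X}

/-- Two pairs over the same `g` differ by an automorphism commuting with `ρ(H)`: if `(g, M), (g, M') ∈ Mp_ψ(W)`
then `M⁻¹ M'` commutes with every `ρ(h)`. [cite: MoeglinVignerasWaldspurger1987, Chap. 2 II.1 (A)] -/
theorem MpPsi.commute_of_proj_eq {p q : MpPsi ρ} (h : MpPsi.proj ρ p = MpPsi.proj ρ q) (a : Heisenberg B) (f : S) :
    ((p : symplecticGroup B × (S ≃ₗ[k] S)).2⁻¹ * (q : symplecticGroup B × (S ≃ₗ[k] S)).2) (ρ a f) =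
      ρ a (((p : symplecticGroup B × (S ≃ₗ[k] S)).2⁻¹ * (q : symplecticGroup B × (S ≃ₗ[k] S)).2) f) := by
  have hmem : (p⁻¹ * q : MpPsi ρ).1 ∈ MpPsi ρ := (p⁻¹ * q).2
  rw [mem_MpPsi] at hmem
  have h1 : ((p⁻¹ * q : MpPsi ρ) : symplecticGroup B × (S ≃ₗ[k] S)).1 = 1 := by
    rw [MpPsi.proj_apply, MpPsi.proj_apply] at h
    rw [Subgroup.coe_mul, Subgroup.coe_inv, Prod.fst_mul, Prod.fst_inv, h, inv_mul_cancel]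
  have := hmem a f
  rw [h1, map_one, Heisenberg.PseudoSymplectic.act_one] at this
  simpa only [Subgroup.coe_mul, Subgroup.coe_inv, Prod.snd_mul, Prod.snd_inv] using this

/-- **RIGIDITY ⇒ `π` IS INJECTIVE ON THE `Θ`-FIXING PAIRS**: two `Θ`-fixing pairs over the same `g ∈ Sp(W)` are
equal (the quotient `M⁻¹M'` commutes with `ρ(H)` and fixes `Θ`). [cite: Weil1964, Chap. III n° 41 Thm 6 p. 193] -/
theorem MpPsi.eq_of_proj_eq_of_mem_fixing (hrig : ThetaRigid ρ Θ) {p q : MpPsi ρ} (hp : p ∈ MpPsi.fixing ρ Θ)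
    (hq : q ∈ MpPsi.fixing ρ Θ) (h : MpPsi.proj ρ p = MpPsi.proj ρ q) : p = q := by
  have hC : (p : symplecticGroup B × (S ≃ₗ[k] S)).2⁻¹ * (q : symplecticGroup B × (S ≃ₗ[k] S)).2 ∈ fixer Θ := by
    have := (MpPsi.fixing ρ Θ).mul_mem ((MpPsi.fixing ρ Θ).inv_mem hp) hq
    simpa only [MpPsi.fixing, Subgroup.mem_comap, map_mul, map_inv, MpPsi.toOp_apply] using this
  have h1 := hrig _ (MpPsi.commute_of_proj_eq h) hC
  have h2 : (p : symplecticGroup B × (S ≃ₗ[k] S)).2 = (q : symplecticGroup B × (S ≃ₗ[k] S)).2 := by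
    rw [← mul_one (p : symplecticGroup B × (S ≃ₗ[k] S)).2, ← h1, mul_inv_cancel_left]
  rw [MpPsi.proj_apply, MpPsi.proj_apply] at h
  exact Subtype.ext (Prod.ext h h2)

variable (ρ Θ)

/-- `π` restricted to the `Θ`-fixing pairs. [folklore] -/
def MpPsi.fixingProj : MpPsi.fixing ρ Θ →* symplecticGroup B := (MpPsi.proj ρ).comp (MpPsi.fixing ρ Θ).subtype

/-- formula. [folklore] -/
@[simp] theorem MpPsi.fixingProj_apply (p : MpPsi.fixing ρ Θ) :
    MpPsi.fixingProj ρ Θ p = MpPsi.proj ρ (p : MpPsi ρ) := rfl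

/-- **The `Θ`-liftable elements of `Sp(W)`**: those `g` admitting a pair `(g, M) ∈ Mp_ψ(W)` with `M` fixing `Θ` —
a subgroup (the image of `MpPsi.fixing` under `π`). [cite: Weil1964, Chap. III n° 40 p. 190] -/
def liftable : Subgroup (symplecticGroup B) := (MpPsi.fixingProj ρ Θ).range

/-- membership. [cite: Weil1964, Chap. III n° 40 p. 190] -/
theorem mem_liftable_iff (g : symplecticGroup B) :
    g ∈ liftable ρ Θ ↔ ∃ p : MpPsi ρ, p ∈ MpPsi.fixing ρ Θ ∧ MpPsi.proj ρ p = g := by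
  constructor
  · rintro ⟨p, rfl⟩
    exact ⟨p, p.2, rfl⟩
  · rintro ⟨p, hp, rfl⟩
    exact ⟨⟨p, hp⟩, rfl⟩

/-- a concrete witness: `(g, M) ∈ Mp_ψ(W)` with `Θ ∘ M = Θ` makes `g` liftable. [cite: Weil1964, Chap. III n° 40 p. 190] -/
theorem mem_liftable_of_implements {g : symplecticGroup B} {M : S ≃ₗ[k] S} (hM : Implements ρ (ofSymplectic B g) M)
    (hΘ : ∀ f : S, Θ (M f) = Θ f) : g ∈ liftable ρ Θ :=
  (mem_liftable_iff ρ Θ g).2 ⟨⟨(g, M), hM⟩, (MpPsi.mem_fixing_iff ρ Θ _).2 hΘ, rfl⟩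

/-- **GENERATION**: if every element of `T ⊆ Sp(W)` is `Θ`-liftable, so is every element of the subgroup it
generates ([Weil1964, n° 40]: `r_k` is defined on `Ps(X)_k` via its generators). [cite: Weil1964, Chap. III n° 40 p. 190] -/
theorem closure_le_liftable {T : Set (symplecticGroup B)} (hT : T ⊆ liftable ρ Θ) :
    Subgroup.closure T ≤ liftable ρ Θ :=
  (Subgroup.closure_le _).2 hT

variable {ρ Θ}

/-- under rigidity `π|_{fixing}` is injective. [cite: Weil1964, Chap. III n° 41 Thm 6 p. 193] -/
theorem MpPsi.fixingProj_injective (hrig : ThetaRigid ρ Θ) : Function.Injective (MpPsi.fixingProj ρ Θ) :=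
  fun p q h => Subtype.ext (MpPsi.eq_of_proj_eq_of_mem_fixing hrig p.2 q.2 h)

/-- **THE `Θ`-FORCED SECTION** `liftable ρ Θ →* Mp_ψ(W)`: the inverse of the bijective homomorphism
`π : MpPsi.fixing ρ Θ → liftable ρ Θ` (Weil's `r_k` [Weil1964, n° 40 p. 190: "un relèvement de `Ps(X)_k` dans
`Mp(X)_A`, qu'on notera `r_k`"]; GR91's `i`). [cite: Weil1964, Chap. III n° 40 p. 190] -/
def forcedLift (hrig : ThetaRigid ρ Θ) : liftable ρ Θ →* MpPsi ρ :=
  (MpPsi.fixing ρ Θ).subtype.comp (MonoidHom.ofInjective (MpPsi.fixingProj_injective hrig)).symm.toMonoidHom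

/-- the forced section IS a section of `π`. [cite: Weil1964, Chap. III n° 40 p. 190] -/
@[simp] theorem proj_forcedLift (hrig : ThetaRigid ρ Θ) (g : liftable ρ Θ) :
    MpPsi.proj ρ (forcedLift hrig g) = g := by
  have := MonoidHom.apply_ofInjective_symm (MpPsi.fixingProj_injective hrig) g
  rwa [MpPsi.fixingProj_apply] at this

/-- its values fix `Θ`. [cite: Weil1964, Chap. III n° 41 Thm 6 p. 193] -/
theorem forcedLift_mem_fixing (hrig : ThetaRigid ρ Θ) (g : liftable ρ Θ) : forcedLift hrig g ∈ MpPsi.fixing ρ Θ :=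
  ((MonoidHom.ofInjective (MpPsi.fixingProj_injective hrig)).symm g).2

/-- … i.e. `Θ (ω_ψ(forcedLift g) f) = Θ f`. [cite: Weil1964, Chap. III n° 41 Thm 6 p. 193] -/
theorem apply_forcedLift_eq (hrig : ThetaRigid ρ Θ) (g : liftable ρ Θ) (f : S) :
    Θ (omegaPsi ρ (forcedLift hrig g) f) = Θ f :=
  (MpPsi.mem_fixing_iff ρ Θ _).1 (forcedLift_mem_fixing hrig g) f

/-- **UNIQUENESS**: a `Θ`-fixing pair IS the forced lift of its projection. [cite: Weil1964, Chap. III n° 41 Thm 6 p. 193] -/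
theorem eq_forcedLift (hrig : ThetaRigid ρ Θ) {p : MpPsi ρ} (hp : p ∈ MpPsi.fixing ρ Θ) :
    p = forcedLift hrig ⟨MpPsi.proj ρ p, ⟨⟨p, hp⟩, rfl⟩⟩ :=
  MpPsi.eq_of_proj_eq_of_mem_fixing hrig hp (forcedLift_mem_fixing hrig _) (by rw [proj_forcedLift])

/-- **COMPATIBILITY IS FORCED** (the shape of [GelbartRogawski1991, Prop. 3.1.1]'s conclusion): a homomorphism
`s : G →* Mp_ψ(W)` whose values on a subgroup `Γ` fix `Θ` coincides on `Γ` with the forced lift of `π ∘ s`.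
[cite: Weil1964, Chap. III n° 41 Thm 6 p. 193] -/
theorem eq_forcedLift_of_mem_fixing (hrig : ThetaRigid ρ Θ) {G : Type*} [Group G] (s : G →* MpPsi ρ)
    {γ : G} (hγ : s γ ∈ MpPsi.fixing ρ Θ) :
    s γ = forcedLift hrig ⟨MpPsi.proj ρ (s γ), ⟨⟨s γ, hγ⟩, rfl⟩⟩ :=
  eq_forcedLift hrig hγ

/-- two homomorphisms into `Mp_ψ(W)` over the same map to `Sp(W)` whose values at `γ` fix `Θ` agree at `γ` — so
the "character `ν`" comparing two splittings is trivial wherever both fix `Θ`. [cite: Weil1964, Chap. III n° 41 Thm 6 p. 193] -/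
theorem eq_of_proj_eq_of_mem_fixing {G : Type*} [Group G] (hrig : ThetaRigid ρ Θ) (s s' : G →* MpPsi ρ)
    {γ : G} (hγ : s γ ∈ MpPsi.fixing ρ Θ) (hγ' : s' γ ∈ MpPsi.fixing ρ Θ)
    (h : MpPsi.proj ρ (s γ) = MpPsi.proj ρ (s' γ)) : s γ = s' γ :=
  MpPsi.eq_of_proj_eq_of_mem_fixing hrig hγ hγ' h

end Generic

/-! ## §2 Generic: restricting an intertwining pair to a stable sub-representation -/

section Restrict

variable {k : Type u'} [CommRing k] {S : Type v'} [AddCommGroup S] [Module k S]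

/-- restriction of a linear automorphism `M` of `S` preserving a submodule `W` in both directions to a linear
automorphism of `W` (weil-1's `restrictSB`, for an arbitrary submodule). [folklore] -/
def restrictEquiv (M : S ≃ₗ[k] S) (W : Submodule k S) (hM : ∀ f ∈ W, M f ∈ W) (hM' : ∀ f ∈ W, M.symm f ∈ W) :
    W ≃ₗ[k] W where
  toFun f := ⟨M f, hM f f.2⟩
  map_add' f g := Subtype.ext (M.map_add f g)
  map_smul' c f := Subtype.ext (M.map_smul c f)
  invFun f := ⟨M.symm f, hM' f f.2⟩
  left_inv f := Subtype.ext (M.symm_apply_apply (f : S))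
  right_inv f := Subtype.ext (M.apply_symm_apply (f : S))

/-- formula. [folklore] -/
@[simp] theorem coe_restrictEquiv (M : S ≃ₗ[k] S) (W : Submodule k S) (hM : ∀ f ∈ W, M f ∈ W)
    (hM' : ∀ f ∈ W, M.symm f ∈ W) (f : W) : ((restrictEquiv M W hM hM' f : W) : S) = M f := rfl

variable {R : Type u} [CommRing R] {V : Type v} [AddCommGroup V] [Module R V] {B : V →ₗ[R] V →ₗ[R] R}
  {ρ : Representation k (Heisenberg B) S}

/-- **transfer of condition (A) to a stable sub-representation**: if `(s, M)` satisfies (A) for `ρ` and `M^{±1}`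
preserve `W`, then `(s, M|_W)` satisfies (A) for `ρ|_W`. [cite: MoeglinVignerasWaldspurger1987, Chap. 2 II.1 (A)] -/
theorem restrict_mem_mpPairs (W : Subrepresentation ρ) {s : Heisenberg.PseudoSymplectic B} {M : S ≃ₗ[k] S}
    (hM : ∀ f ∈ W.toSubmodule, M f ∈ W.toSubmodule) (hM' : ∀ f ∈ W.toSubmodule, M.symm f ∈ W.toSubmodule)
    (h : (s, M) ∈ mpPairs ρ) : (s, restrictEquiv M W.toSubmodule hM hM') ∈ mpPairs W.toRepresentation := by
  rw [mem_mpPairs] at h ⊢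
  intro a f
  apply Subtype.ext
  exact h a f

/-- the same at the level of `MpPsi` (`g ∈ Sp(W)` acting through `ofSymplectic`).
[cite: MoeglinVignerasWaldspurger1987, Chap. 2 II.1 (A)] -/
theorem restrict_mem_MpPsi [Invertible (2 : R)] (W : Subrepresentation ρ) {g : symplecticGroup B} {M : S ≃ₗ[k] S}
    (hM : ∀ f ∈ W.toSubmodule, M f ∈ W.toSubmodule) (hM' : ∀ f ∈ W.toSubmodule, M.symm f ∈ W.toSubmodule)
    (h : (g, M) ∈ MpPsi ρ) : (g, restrictEquiv M W.toSubmodule hM hM') ∈ MpPsi W.toRepresentation :=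
  restrict_mem_mpPairs W hM hM' h

end Restrict

/-! ## §3 The adelic instance: `Mp_ψ(W_𝔸)`, `Θ`-rigidity, the rational section -/

section Adelic

variable (F : Type) [Field F] [NumberField F] (ι : Type) [Fintype ι] [DecidableEq ι]

/-- `2` is invertible in the adele ring of a number field (`𝔸_F` is an `F`-algebra, `char F = 0`), so that weil-1's
section `ofSymplectic : Sp(W_𝔸) → B₀` and the group `MpPsi` are available.  The inverse is `algebraMap F 𝔸_F (2⁻¹)`.
[folklore] -/
instance invertibleTwoAdeleRing : Invertible (2 : AdeleRing (𝓞 F) F) where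
  invOf := algebraMap F (AdeleRing (𝓞 F) F) (2⁻¹ : F)
  invOf_mul_self := by
    rw [← map_ofNat (algebraMap F (AdeleRing (𝓞 F) F)) 2, ← map_mul, inv_mul_cancel₀ (two_ne_zero' F), map_one]
  mul_invOf_self := by
    rw [← map_ofNat (algebraMap F (AdeleRing (𝓞 F) F)) 2, ← map_mul, mul_inv_cancel₀ (two_ne_zero' F), map_one]

variable (T : Matrix ι ι (AdeleRing (𝓞 F) F))

/-- **`Mp_ψ(W_𝔸)`** = GR91's `Mp_𝐀(W)`: the pairs `(g, M)`, `g ∈ Sp(W_𝔸)`, `M ∈ GL(𝒮(𝔸_F^ι))`, with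
`M ρ_ψ(h) M⁻¹ = ρ_ψ(g h)` — weil-1's `MpPsi` AT the constructed global Schrödinger representation (smooth model).
[cite: GelbartRogawski1991, §3.1 p. 454] -/
abbrev adelicMp : Subgroup (symplecticGroup (polar (adelicForm F ι T)) × (piSchwartzBruhat F ι ≃ₗ[ℂ] piSchwartzBruhat F ι)) :=
  MpPsi (adelicSchrodinger F ι T)

/-- **the `Θ`-fixing pairs `Mp_ψ(W_𝔸)^Θ`**: `Θ(M Φ) = Θ(Φ)` for all `Φ ∈ 𝒮(𝔸_F^ι)`, `Θ = thetaDistLM`.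
[cite: Weil1964, Chap. III n° 41 Thm 6 p. 193] -/
abbrev adelicMpTheta : Subgroup (adelicMp F ι T) :=
  MpPsi.fixing (adelicSchrodinger F ι T) (thetaDistLM F ι : piSchwartzBruhat F ι → ℂ)

variable {F ι T}

/-- membership in `Mp_ψ(W_𝔸)^Θ`, spelled with the theta distribution on functions.
[cite: Weil1964, Chap. III n° 41 Thm 6 p. 193] -/
theorem mem_adelicMpTheta_iff (p : adelicMp F ι T) :
    p ∈ adelicMpTheta F ι T ↔ ∀ Φ : piSchwartzBruhat F ι,
      thetaDist F ι (MpPsi.toOp (adelicSchrodinger F ι T) p Φ : (ι → AdeleRing (𝓞 F) F) → ℂ) =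
        thetaDist F ι (Φ : (ι → AdeleRing (𝓞 F) F) → ℂ) := by
  simp only [MpPsi.mem_fixing_iff, MpPsi.toOp_apply, thetaDistLM_apply]

omit [DecidableEq ι] in
/-- **BRIDGE to theta-1's `thetaStabilizer ≤ GL(𝒮)`** (units of `End` versus linear automorphisms, Mathlib
`GeneralLinearGroup.ofLinearEquiv`): `M` fixes `Θ` iff `ofLinearEquiv M ∈ thetaStabilizer F ι`. [folklore] -/
theorem mem_fixer_thetaDistLM_iff (M : piSchwartzBruhat F ι ≃ₗ[ℂ] piSchwartzBruhat F ι) :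
    M ∈ fixer (M := piSchwartzBruhat F ι ≃ₗ[ℂ] piSchwartzBruhat F ι) (thetaDistLM F ι : piSchwartzBruhat F ι → ℂ) ↔
      LinearMap.GeneralLinearGroup.ofLinearEquiv M ∈ thetaStabilizer F ι := by
  rw [mem_fixer_iff, mem_thetaStabilizer_iff]
  rfl

/-- the same for pairs: `p ∈ Mp_ψ(W_𝔸)^Θ ↔ ofLinearEquiv (toOp p) ∈ thetaStabilizer F ι`. [folklore] -/
theorem mem_adelicMpTheta_iff_thetaStabilizer (p : adelicMp F ι T) :
    p ∈ adelicMpTheta F ι T ↔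
      LinearMap.GeneralLinearGroup.ofLinearEquiv (MpPsi.toOp (adelicSchrodinger F ι T) p) ∈ thetaStabilizer F ι := by
  rw [← mem_fixer_thetaDistLM_iff]
  rfl

variable (T) in
/-- **`Θ`-RIGIDITY OF THE GLOBAL SCHRÖDINGER MODEL** (for `y ↦ T y` surjective, e.g. `T ∈ GL_ι(F)`): a linear
automorphism of `𝒮(𝔸_F^ι)` commuting with `ρ_ψ(H(W_𝔸))` and fixing `Θ` is the identity — theta separation
(`AdelicHeisenbergSchrodinger.eq_id_of_commute_of_thetaDist_eq`).  No irreducibility / Schur lemma is used.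
[cite: Weil1964, Chap. III n° 41 Thm 6 p. 193] -/
theorem thetaRigid_adelicSchrodinger (hT : Function.Surjective fun y : ι → AdeleRing (𝓞 F) F => T *ᵥ y) :
    ThetaRigid (adelicSchrodinger F ι T) (thetaDistLM F ι : piSchwartzBruhat F ι → ℂ) := by
  intro C hC hΘ
  apply LinearEquiv.toLinearMap_injective
  refine eq_id_of_commute_of_thetaDist_eq T hT (C : piSchwartzBruhat F ι →ₗ[ℂ] piSchwartzBruhat F ι)
    (fun x y => LinearMap.ext fun Φ => hC _ Φ) fun Φ => ?_
  have := (mem_fixer_iff _ C).1 hΘ Φ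
  rwa [LinearEquiv.smul_def, thetaDistLM_apply, thetaDistLM_apply] at this

/-- hence: **two `Θ`-fixing pairs over the same `g ∈ Sp(W_𝔸)` are EQUAL** (`π` is injective on `Mp_ψ(W_𝔸)^Θ`).
[cite: Weil1964, Chap. III n° 41 Thm 6 p. 193] -/
theorem adelicMp_eq_of_proj_eq (hT : Function.Surjective fun y : ι → AdeleRing (𝓞 F) F => T *ᵥ y)
    {p q : adelicMp F ι T} (hp : p ∈ adelicMpTheta F ι T) (hq : q ∈ adelicMpTheta F ι T)
    (h : MpPsi.proj _ p = MpPsi.proj _ q) : p = q :=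
  MpPsi.eq_of_proj_eq_of_mem_fixing (thetaRigid_adelicSchrodinger T hT) hp hq h

variable (F ι T)

/-- **the `Θ`-liftable subgroup of `Sp(W_𝔸)`** (contains `Sp_F(W)` once the rational generators are lifted:
sequel files). [cite: Weil1964, Chap. III n° 40 p. 190] -/
abbrev adelicLiftable : Subgroup (symplecticGroup (polar (adelicForm F ι T))) :=
  liftable (adelicSchrodinger F ι T) (thetaDistLM F ι : piSchwartzBruhat F ι → ℂ)

variable {F ι}

/-- **WEIL'S `r_F` / GR91'S `i` on the constructed carriers**: the unique `Θ`-fixing section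
`adelicLiftable F ι T →* Mp_ψ(W_𝔸)` of `π`. [cite: Weil1964, Chap. III n° 40 p. 190] -/
def adelicThetaLift (hT : Function.Surjective fun y : ι → AdeleRing (𝓞 F) F => T *ᵥ y) :
    adelicLiftable F ι T →* adelicMp F ι T :=
  forcedLift (thetaRigid_adelicSchrodinger T hT)

/-- `π ∘ r_F = id`. [cite: Weil1964, Chap. III n° 40 p. 190] -/
@[simp] theorem proj_adelicThetaLift (hT : Function.Surjective fun y : ι → AdeleRing (𝓞 F) F => T *ᵥ y)
    (g : adelicLiftable F ι T) : MpPsi.proj _ (adelicThetaLift T hT g) = g :=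
  proj_forcedLift _ g

/-- **theta invariance of the lifted operators**: `Θ(ω_ψ(r_F(g)) Φ) = Θ(Φ)` ([Weil1964, Thm 6]: "`Θ S = Θ`").
[cite: Weil1964, Chap. III n° 41 Thm 6 p. 193] -/
theorem thetaDist_omegaPsi_adelicThetaLift (hT : Function.Surjective fun y : ι → AdeleRing (𝓞 F) F => T *ᵥ y)
    (g : adelicLiftable F ι T) (Φ : piSchwartzBruhat F ι) :
    thetaDist F ι (omegaPsi _ (adelicThetaLift T hT g) Φ : (ι → AdeleRing (𝓞 F) F) → ℂ) =
      thetaDist F ι (Φ : (ι → AdeleRing (𝓞 F) F) → ℂ) := by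
  have := apply_forcedLift_eq (thetaRigid_adelicSchrodinger T hT) g Φ
  rwa [thetaDistLM_apply, thetaDistLM_apply] at this

/-- the lifted pairs lie in `Mp_ψ(W_𝔸)^Θ`. [cite: Weil1964, Chap. III n° 41 Thm 6 p. 193] -/
theorem adelicThetaLift_mem (hT : Function.Surjective fun y : ι → AdeleRing (𝓞 F) F => T *ᵥ y)
    (g : adelicLiftable F ι T) : adelicThetaLift T hT g ∈ adelicMpTheta F ι T :=
  forcedLift_mem_fixing _ g

/-- **UNIQUENESS of `r_F`**: any `Θ`-fixing pair over a liftable `g` is `r_F(g)`; in particular any homomorphism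
`s : G →* Mp_ψ(W_𝔸)` agrees with `r_F ∘ (π ∘ s)` at every `γ` where `s γ` fixes `Θ` — the tree's form of
"`s(G(F)) ⊆ i(Sp_F(W))`" [GelbartRogawski1991, Prop. 3.1.1]. [cite: Weil1964, Chap. III n° 41 Thm 6 p. 193] -/
theorem eq_adelicThetaLift (hT : Function.Surjective fun y : ι → AdeleRing (𝓞 F) F => T *ᵥ y)
    {p : adelicMp F ι T} (hp : p ∈ adelicMpTheta F ι T) :
    p = adelicThetaLift T hT ⟨MpPsi.proj _ p, ⟨⟨p, hp⟩, rfl⟩⟩ :=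
  eq_forcedLift _ hp

end Adelic

/-! ## §4 The topology of `Mp_ψ(W_𝔸)`: initial for `π` and the matrix coefficients of `ω_ψ` -/

section Topology

open _root_.Topology _root_.TopologicalSpace

variable (F : Type) [Field F] [NumberField F] (ι : Type) [Fintype ι] [DecidableEq ι]
  (T : Matrix ι ι (AdeleRing (𝓞 F) F))

/-- **Topology on `Mp_ψ(W_𝔸)`**: the INITIAL topology of the maps `p ↦ π(p) w ∈ W_𝔸` (`w ∈ W_𝔸 = 𝔸_F^ι × 𝔸_F^ι`,
product topology of the adele ring — i.e. `π` continuous for the adelic topology of `Sp(W_𝔸) ⊂ M_{2ι}(𝔸_F)`) and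
`p ↦ (ω_ψ(p)Φ)(x) ∈ ℂ` (`Φ ∈ 𝒮(𝔸_F^ι)`, `x ∈ 𝔸_F^ι`: the pointwise topology of the operators).  It is COARSER than
the topology of [GelbartRogawski1991, §3.1 p. 454] / [Weil1964, Chap. III n° 34–39] (restricted product of the local
metaplectic groups), for which `π` is continuous and `Mp(X)_A` acts continuously on `𝒮(X_A)` [Weil1964, n° 39];
so a section continuous in the printed sense is continuous here. [cite: Weil1964, Chap. III n° 39 p. 189] -/
instance topologicalSpace_adelicMp : TopologicalSpace (adelicMp F ι T) :=
  (⨅ w : (ι → AdeleRing (𝓞 F) F) × (ι → AdeleRing (𝓞 F) F),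
      induced (fun p : adelicMp F ι T =>
        ((MpPsi.proj (adelicSchrodinger F ι T) p : symplecticGroup (polar (adelicForm F ι T))) :
          ((ι → AdeleRing (𝓞 F) F) × (ι → AdeleRing (𝓞 F) F)) ≃ₗ[AdeleRing (𝓞 F) F]
            ((ι → AdeleRing (𝓞 F) F) × (ι → AdeleRing (𝓞 F) F))) w) inferInstance) ⊓
    ⨅ (Φ : piSchwartzBruhat F ι) (x : ι → AdeleRing (𝓞 F) F),
      induced (fun p : adelicMp F ι T =>
        ((omegaPsi (adelicSchrodinger F ι T) p Φ : piSchwartzBruhat F ι) : (ι → AdeleRing (𝓞 F) F) → ℂ) x)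
        inferInstance

variable {F ι T}

/-- the orbit maps of `π` are continuous. [cite: Weil1964, Chap. III n° 39 p. 189] -/
theorem continuous_proj_apply (w : (ι → AdeleRing (𝓞 F) F) × (ι → AdeleRing (𝓞 F) F)) :
    Continuous fun p : adelicMp F ι T =>
      ((MpPsi.proj (adelicSchrodinger F ι T) p : symplecticGroup (polar (adelicForm F ι T))) :
        ((ι → AdeleRing (𝓞 F) F) × (ι → AdeleRing (𝓞 F) F)) ≃ₗ[AdeleRing (𝓞 F) F]
          ((ι → AdeleRing (𝓞 F) F) × (ι → AdeleRing (𝓞 F) F))) w :=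
  continuous_iff_le_induced.2 (inf_le_left.trans (iInf_le _ w))

/-- the matrix coefficients `p ↦ (ω_ψ(p)Φ)(x)` are continuous. [cite: Weil1964, Chap. III n° 39 p. 189] -/
theorem continuous_omegaPsi_apply (Φ : piSchwartzBruhat F ι) (x : ι → AdeleRing (𝓞 F) F) :
    Continuous fun p : adelicMp F ι T =>
      ((omegaPsi (adelicSchrodinger F ι T) p Φ : piSchwartzBruhat F ι) : (ι → AdeleRing (𝓞 F) F) → ℂ) x :=
  continuous_iff_le_induced.2 (inf_le_right.trans ((iInf_le _ Φ).trans (iInf_le _ x)))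

/-- **universal property**: a map into `Mp_ψ(W_𝔸)` is continuous iff all `z ↦ π(f z) w` and `z ↦ (ω_ψ(f z)Φ)(x)`
are — the form in which the continuity of a splitting `s : G(𝔸) → Mp_ψ(W_𝔸)` is established or consumed.
[folklore] -/
theorem continuous_into_adelicMp_iff {Z : Type*} [TopologicalSpace Z] (f : Z → adelicMp F ι T) :
    Continuous f ↔
      (∀ w : (ι → AdeleRing (𝓞 F) F) × (ι → AdeleRing (𝓞 F) F), Continuous fun z =>
        ((MpPsi.proj (adelicSchrodinger F ι T) (f z) : symplecticGroup (polar (adelicForm F ι T))) :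
          ((ι → AdeleRing (𝓞 F) F) × (ι → AdeleRing (𝓞 F) F)) ≃ₗ[AdeleRing (𝓞 F) F]
            ((ι → AdeleRing (𝓞 F) F) × (ι → AdeleRing (𝓞 F) F))) w) ∧
      ∀ (Φ : piSchwartzBruhat F ι) (x : ι → AdeleRing (𝓞 F) F), Continuous fun z =>
        ((omegaPsi (adelicSchrodinger F ι T) (f z) Φ : piSchwartzBruhat F ι) : (ι → AdeleRing (𝓞 F) F) → ℂ) x := by
  constructor
  · intro hf
    exact ⟨fun w => (continuous_proj_apply w).comp hf, fun Φ x => (continuous_omegaPsi_apply Φ x).comp hf⟩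
  · rintro ⟨h1, h2⟩
    refine continuous_inf_rng.2 ⟨continuous_iInf_rng.2 fun w => continuous_induced_rng.2 (h1 w),
      continuous_iInf_rng.2 fun Φ => continuous_iInf_rng.2 fun x => continuous_induced_rng.2 (h2 Φ x)⟩

/-- in particular the terms of the theta series `p ↦ (ω_ψ(p)Φ)(ξ)`, `ξ ∈ F^ι`, are continuous on `Mp_ψ(W_𝔸)` —
conjunct (i) of theta-2's `HasThetaMajorants` for `ω_ψ` itself, hence for `ω_ψ ∘ s` along any continuous `s`.
[cite: Weil1964, Chap. III n° 41 Lemme 5 p. 192] -/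
theorem continuous_omegaPsi_apply_ratPt (Φ : piSchwartzBruhat F ι) (ξ : ι → F) :
    Continuous fun p : adelicMp F ι T =>
      ((omegaPsi (adelicSchrodinger F ι T) p Φ : piSchwartzBruhat F ι) : (ι → AdeleRing (𝓞 F) F) → ℂ) (ratPt F ι ξ) :=
  continuous_omegaPsi_apply Φ _

end Topology

end Literature.NumberTheory.Weil1964
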